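import Mathlib.NumberTheory.Height.NumberField
import Mathlib.NumberTheory.NumberField.ProductFormula
import Mathlib.Analysis.Polynomial.MahlerMeasure
import Mathlib.RingTheory.Polynomial.GaussNorm
import Mathlib.RingTheory.Polynomial.GaussLemma
import Mathlib.FieldTheory.Normal.Basic
import Literature.NumberTheory.EllipticCurves.HeightsBaseChangeProofs
import Literature.NumberTheory.Transcendental.QuadraticRelationsLogarithmsWeilHeight
import HarnessLib

/-!
# The Weil height of an algebraic number and the Mahler measure of its minimal polynomial

For an irreducible `P ∈ ℤ[X]` of degree `d ≥ 1` and a complex root `α` of `P`, the absolute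
logarithmic Weil height of `α` is `h(α) = (1/d) log M(P)` (Mahler measure).  This classical
identity (Bombieri–Gubler, *Heights in Diophantine Geometry*, Prop. 1.6.6; Waldschmidt,
*Diophantine Approximation on Linear Algebraic Groups*, Lemma 3.10) is the bridge between the
conclusion of Roy–Waldschmidt's Théorème 3.2 (`RoyWaldschmidt1997.thm_3_2`, stated with the
Mahler measure of an approximating polynomial) and the hypothesis `h₁(ã) ≤ κ` of their
Théorème 3.1 / Théorème 2.1 (Weil heights).  D. Roy, M. Waldschmidt, Ann. Sci. ÉNS 30 (1997),
§3, p. 763: "un nombre algébrique `α` de degré `d` et de hauteur `h₁(α) ≤ κ`".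

PROVED here (no definitions, no named facts), in a number field `L` in which `P` splits:
Gauss's lemma at the finite places (`sum_roots_posLog_finitePlace`: `∑_{P(r)=0} log⁺|r|_v =
-log|a_d|_v`), the archimedean places (`sum_roots_posLog_infinitePlace`:
`∑ log⁺|σ r| = log(M(P)/|a_d|)`), the product formula for `a_d`, Galois conjugation
(all roots have the same height), whence `natDegree P · logHeight₁ α = [L:ℚ] · log M(P)`
(`natDegree_mul_logHeight₁_eq`) and, for the tree's normalised height `weilHeight₁` in any number
field `F ⊂ ℂ` containing `α`, **`weilHeight₁_root_eq : h(α) = log M(P) / d`** and the inequality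
`weilHeight₁_root_le`.

## References

* E. Bombieri, W. Gubler, *Heights in Diophantine Geometry*, CUP 2006, Prop. 1.6.6.
* [RoyWaldschmidt1997ENS] D. Roy, M. Waldschmidt, Ann. Sci. ÉNS (4) 30 (1997) 753–796, §3 p. 763.
-/

noncomputable section

open Polynomial NumberField Height

namespace Literature.NumberTheory.Transcendental

namespace RoyWaldschmidt1997

namespace MahlerWeil

/-! ### Gauss norms at a non-archimedean absolute value -/

section gauss

variable {L : Type*} [Field L] (v : AbsoluteValue L ℝ)

/-- `‖p‖_v ≤ B` iff all `|coeff|_v ≤ B` (`B ≥ 0`, Gauss norm with `c = 1`). [folklore] -/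
theorem gaussNorm_one_le_iff {p : L[X]} {B : ℝ} :
    p.gaussNorm v 1 ≤ B ↔ ∀ i, v (p.coeff i) ≤ B := by
  constructor
  · intro h i
    have := p.le_gaussNorm v zero_le_one i
    rw [one_pow, mul_one] at this
    exact this.trans h
  · intro h
    obtain ⟨i, hi⟩ := p.exists_eq_gaussNorm v 1
    rw [hi, one_pow, mul_one]
    exact h i

/-- `|coeff i|_v ≤ ‖p‖_v`. [folklore] -/
theorem apply_coeff_le_gaussNorm_one (p : L[X]) (i : ℕ) : v (p.coeff i) ≤ p.gaussNorm v 1 := by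
  have := p.le_gaussNorm v zero_le_one i
  rwa [one_pow, mul_one] at this

/-- `‖X - r‖_v = max(1, |r|_v)`. [folklore] -/
theorem gaussNorm_X_sub_C (r : L) : (X - C r).gaussNorm v 1 = max 1 (v r) := by
  apply le_antisymm
  · rw [gaussNorm_one_le_iff v]
    intro i
    rw [coeff_sub, coeff_X, coeff_C]
    rcases Nat.lt_trichotomy i 1 with hi | rfl | hi
    · have : i = 0 := by omega
      subst this; simp
    · simp
    · have h1 : (1 : ℕ) ≠ i := by omega
      have h0 : i ≠ 0 := by omega
      simp [h1, h0]
  · refine max_le ?_ ?_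
    · have := apply_coeff_le_gaussNorm_one v (X - C r) 1
      simpa using this
    · have := apply_coeff_le_gaussNorm_one v (X - C r) 0
      simpa using this

/-- Gauss's lemma for a product of linear factors: `‖∏ (X - rᵢ)‖_v = ∏ max(1, |rᵢ|_v)` at a
non-archimedean `v`. [folklore] -/
theorem gaussNorm_prod_X_sub_C (hna : IsNonarchimedean v) (s : Multiset L) :
    (s.map fun r => X - C r).prod.gaussNorm v 1 = (s.map fun r => max 1 (v r)).prod := by
  induction s using Multiset.induction_on with
  | empty => simp only [Multiset.map_zero, Multiset.prod_zero]; rw [← C_1, gaussNorm_C, map_one]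
  | cons a s ih =>
    rw [Multiset.map_cons, Multiset.prod_cons, gaussNorm_mul hna one_pos, ih, gaussNorm_X_sub_C,
      Multiset.map_cons, Multiset.prod_cons]

end gauss

/-! ### The Gauss norm of a primitive integer polynomial at a finite place is `1` -/

section finite

variable {L : Type*} [Field L] [NumberField L]

/-- At a finite place `w` of a number field, every rational integer has `|n|_w ≤ 1`. [folklore] -/
theorem finitePlace_intCast_le_one (w : FinitePlace L) (n : ℤ) : w (n : L) ≤ 1 := by
  rw [← FinitePlace.mk_maximalIdeal w, FinitePlace.mk_apply]
  have h := FinitePlace.norm_le_one L (FinitePlace.maximalIdeal w) (n : 𝓞 L)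
  simpa using h

/-- **A primitive integer polynomial has Gauss norm `1` at every finite place.** [folklore] -/
theorem gaussNorm_map_eq_one (w : FinitePlace L) {P : ℤ[X]} (hP : P.IsPrimitive) :
    (P.map (Int.castRingHom L)).gaussNorm w.val 1 = 1 := by
  classical
  apply le_antisymm
  · rw [gaussNorm_one_le_iff w.val]
    intro i
    rw [coeff_map, eq_intCast]
    exact finitePlace_intCast_le_one w _
  · -- some coefficient is a `w`-unit
    by_contra hlt
    push Not at hlt
    set v := FinitePlace.maximalIdeal w with hv
    have hall : ∀ i, ((P.coeff i : 𝓞 L)) ∈ v.asIdeal := by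
      intro i
      have h1 : w.val ((P.map (Int.castRingHom L)).coeff i) < 1 :=
        lt_of_le_of_lt (apply_coeff_le_gaussNorm_one w.val _ i) hlt
      rw [coeff_map, eq_intCast] at h1
      have h2 : ‖FinitePlace.embedding v (algebraMap (𝓞 L) L (P.coeff i : 𝓞 L))‖ < 1 := by
        have e : w.val (P.coeff i : L) = w (P.coeff i : L) := rfl
        rw [e, ← FinitePlace.mk_maximalIdeal w, FinitePlace.mk_apply] at h1
        simpa using h1
      exact (FinitePlace.norm_lt_one_iff_mem L v _).mp h2
    -- the prime of `ℤ` under `v`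
    set I : Ideal ℤ := v.asIdeal.comap (algebraMap ℤ (𝓞 L)) with hI
    have hIprime : I.IsPrime := Ideal.IsPrime.comap _
    have hIne : I ≠ ⊥ := by
      intro h0
      exact v.ne_bot (Ideal.eq_bot_of_comap_eq_bot h0)
    obtain ⟨g, hg⟩ := (Submodule.IsPrincipal.principal I : ∃ g, I = Ideal.span {g})
    have hg0 : g ≠ 0 := by
      intro h; apply hIne; rw [hg, h, Ideal.span_singleton_eq_bot]
    have hgprime : Prime g := (Ideal.span_singleton_prime hg0).mp (by rw [hg] at hIprime; exact hIprime)
    have hdvd : ∀ i, g ∣ P.coeff i := by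
      intro i
      have : P.coeff i ∈ I := by
        rw [hI, Ideal.mem_comap]
        simpa using hall i
      rw [hg, Ideal.mem_span_singleton] at this
      exact this
    have hC : C g ∣ P := (C_dvd_iff_dvd_coeff g P).mpr hdvd
    exact hgprime.not_unit (hP g hC)

end finite

/-! ### The roots of `P` in a number field where it splits -/

section main

variable {L : Type*} [Field L] [NumberField L]

/-- `log ∏ max(1, f r) = ∑ log max(1, f r)` over a multiset. [folklore] -/
theorem log_prod_max_one {α : Type*} (s : Multiset α) (f : α → ℝ) :
    Real.log (s.map fun r => max 1 (f r)).prod = (s.map fun r => Real.log (max 1 (f r))).sum := by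
  rw [Real.log_multiset_prod, Multiset.map_map]
  · rfl
  · intro x hx
    obtain ⟨r, -, rfl⟩ := Multiset.mem_map.mp hx
    exact (lt_of_lt_of_le one_pos (le_max_left _ _)).ne'

variable {P : ℤ[X]}

/-- Notation-free form of the factorisation of `P` in `L[X]` when it splits there:
`P = a_d ∏ (X - r)`. [folklore] -/
theorem map_eq_C_mul_prod (hsplit : (P.map (Int.castRingHom L)).roots.card = P.natDegree) :
    C (P.leadingCoeff : L) * ((P.map (Int.castRingHom L)).roots.map fun r => X - C r).prod =
      P.map (Int.castRingHom L) := by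
  have hnat : (P.map (Int.castRingHom L)).natDegree = P.natDegree :=
    natDegree_map_eq_of_injective (Int.castRingHom L).injective_int P
  have hlead : (P.map (Int.castRingHom L)).leadingCoeff = (P.leadingCoeff : L) := by
    rw [leadingCoeff_map_of_injective (Int.castRingHom L).injective_int, eq_intCast]
  have h := C_leadingCoeff_mul_prod_multiset_X_sub_C (p := P.map (Int.castRingHom L)) (by rw [hsplit, hnat])
  rwa [hlead] at h

/-- **Gauss's lemma at a finite place**: `∑_{P(r)=0} log max(1, |r|_w) = -log |a_d|_w` for a
primitive `P ∈ ℤ[X]` splitting in `L`. [folklore] -/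
theorem sum_roots_log_finitePlace (w : FinitePlace L) (hP : P.IsPrimitive)
    (hsplit : (P.map (Int.castRingHom L)).roots.card = P.natDegree) :
    ((P.map (Int.castRingHom L)).roots.map fun r => Real.log (max 1 (w r))).sum =
      -Real.log (w (P.leadingCoeff : L)) := by
  have hna : IsNonarchimedean w.val := fun x y => FinitePlace.add_le w x y
  have h1 := gaussNorm_map_eq_one w hP
  rw [← map_eq_C_mul_prod hsplit, gaussNorm_mul hna one_pos, gaussNorm_C,
    gaussNorm_prod_X_sub_C w.val hna] at h1
  -- `h1 : |a_d|_w * ∏ max(1,|r|_w) = 1`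
  have hlead0 : (P.leadingCoeff : L) ≠ 0 := by
    intro h0
    have : P.leadingCoeff = 0 := by exact_mod_cast h0
    rw [leadingCoeff_eq_zero] at this
    subst this
    simp at h1
  have hwpos : 0 < w.val (P.leadingCoeff : L) := w.val.pos hlead0
  have hprodpos : 0 < ((P.map (Int.castRingHom L)).roots.map fun r => max 1 (w.val r)).prod := by
    refine Multiset.prod_pos fun x hx => ?_
    obtain ⟨r, -, rfl⟩ := Multiset.mem_map.mp hx
    exact lt_of_lt_of_le one_pos (le_max_left _ _)
  have hlog := congrArg Real.log h1
  rw [Real.log_mul hwpos.ne' hprodpos.ne', Real.log_one, log_prod_max_one] at hlog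
  have e : (fun r => Real.log (max 1 (w.val r))) = fun r => Real.log (max 1 (w r)) := rfl
  rw [e] at hlog
  show _ = -Real.log (w.val (P.leadingCoeff : L))
  linarith

/-- **The archimedean places**: `∑_{P(r)=0} log max(1, |σ r|) = log M(P) - log |a_d|` for the
embedding `σ` of an infinite place (`M` = Mahler measure). [folklore] -/
theorem sum_roots_log_infinitePlace (w : InfinitePlace L) (hd : 0 < P.natDegree)
    (hsplit : (P.map (Int.castRingHom L)).roots.card = P.natDegree) :
    ((P.map (Int.castRingHom L)).roots.map fun r => Real.log (max 1 (w r))).sum =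
      Real.log (P.map (Int.castRingHom ℂ)).mahlerMeasure - Real.log |(P.leadingCoeff : ℝ)| := by
  set σ : L →+* ℂ := w.embedding with hσ
  have hmap : (P.map (Int.castRingHom L)).map σ = P.map (Int.castRingHom ℂ) := by
    rw [Polynomial.map_map]
    congr 1
    exact RingHom.ext_int _ _
  have hnat : (P.map (Int.castRingHom L)).natDegree = P.natDegree :=
    natDegree_map_eq_of_injective (Int.castRingHom L).injective_int P
  have hroots : ((P.map (Int.castRingHom L)).roots.map σ) = (P.map (Int.castRingHom ℂ)).roots := by
    rw [← hmap]
    exact roots_map_of_injective_of_card_eq_natDegree σ.injective (by rw [hsplit, hnat])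
  have hM := mahlerMeasure_eq_leadingCoeff_mul_prod_roots (P.map (Int.castRingHom ℂ))
  have hleadC : (P.map (Int.castRingHom ℂ)).leadingCoeff = (P.leadingCoeff : ℂ) := by
    rw [leadingCoeff_map_of_injective (Int.castRingHom ℂ).injective_int, eq_intCast]
  have hP0 : P ≠ 0 := by rintro rfl; simp at hd
  have hlead0 : P.leadingCoeff ≠ 0 := leadingCoeff_ne_zero.mpr hP0
  have hnormlead : ‖(P.leadingCoeff : ℂ)‖ = |(P.leadingCoeff : ℝ)| := by
    rw [← Complex.ofReal_intCast, Complex.norm_real, Real.norm_eq_abs]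
  have hleadpos : 0 < |(P.leadingCoeff : ℝ)| := abs_pos.mpr (by exact_mod_cast hlead0)
  have hprodpos : 0 < ((P.map (Int.castRingHom ℂ)).roots.map fun a => max 1 ‖a‖).prod := by
    refine Multiset.prod_pos fun x hx => ?_
    obtain ⟨r, -, rfl⟩ := Multiset.mem_map.mp hx
    exact lt_of_lt_of_le one_pos (le_max_left _ _)
  rw [hleadC, hnormlead] at hM
  have hlogM : Real.log (P.map (Int.castRingHom ℂ)).mahlerMeasure =
      Real.log |(P.leadingCoeff : ℝ)| + ((P.map (Int.castRingHom ℂ)).roots.map fun a => Real.log (max 1 ‖a‖)).sum := by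
    rw [hM, Real.log_mul hleadpos.ne' hprodpos.ne', log_prod_max_one]
  rw [hlogM, ← hroots, Multiset.map_map]
  have e : ((fun a : ℂ => Real.log (max 1 ‖a‖)) ∘ σ) = fun r => Real.log (max 1 (w r)) := by
    funext r
    simp only [Function.comp_apply, hσ, InfinitePlace.norm_embedding_eq]
  rw [e]
  ring

/-- Swapping a multiset sum with a finite sum — DEPRECATED restatement of Mathlib's
`Multiset.sum_map_sum` (librarian dedup 2026-08-16, work item dedup-01249); kept under its old name
(never deleted), no longer used in this file. [folklore] -/
@[deprecated Multiset.sum_map_sum (since := "2026-08-16")]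
theorem multiset_sum_map_finset_sum {α β : Type*} (s : Multiset α) (t : Finset β) (f : α → β → ℝ) :
    (s.map fun r => ∑ w ∈ t, f r w).sum = ∑ w ∈ t, (s.map fun r => f r w).sum :=
  Multiset.sum_map_sum

omit [NumberField L] in
/-- An infinite place of an integer: `w(n) = |n|`. [folklore] -/
theorem infinitePlace_intCast (w : InfinitePlace L) (n : ℤ) : w (n : L) = |(n : ℝ)| := by
  rw [← InfinitePlace.norm_embedding_eq, map_intCast, Complex.norm_intCast]

/-- **`∑_{P(r)=0} h_L(r) = [L:ℚ] log M(P)`** for a primitive `P ∈ ℤ[X]` of positive degree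
splitting in the number field `L` (Gauss's lemma at the finite places, the product formula for
the leading coefficient, and `M(P) = |a_d| ∏ max(1,|r|)`). [folklore] -/
theorem sum_roots_logHeight₁ (hP : P.IsPrimitive) (hd : 0 < P.natDegree)
    (hsplit : (P.map (Int.castRingHom L)).roots.card = P.natDegree) :
    ((P.map (Int.castRingHom L)).roots.map fun r => logHeight₁ r).sum =
      Module.finrank ℚ L * Real.log (P.map (Int.castRingHom ℂ)).mahlerMeasure := by
  classical
  set Q := P.map (Int.castRingHom L) with hQ
  set a : L := (P.leadingCoeff : L) with hadef
  have hP0 : P ≠ 0 := by rintro rfl; simp at hd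
  have hlead0 : P.leadingCoeff ≠ 0 := leadingCoeff_ne_zero.mpr hP0
  have ha0 : a ≠ 0 := by rw [hadef]; exact_mod_cast hlead0
  -- a finite set of finite places outside of which `a` and all nonzero roots are units
  set T : Set (FinitePlace L) := (Function.mulSupport fun v : FinitePlace L => v a) ∪
    ⋃ r ∈ {r ∈ Q.roots.toFinset | r ≠ 0}, Function.mulSupport fun v : FinitePlace L => v r with hT
  have hTfin : T.Finite := by
    refine Set.Finite.union (FinitePlace.hasFiniteMulSupport ha0) ?_
    refine Set.Finite.biUnion (Finset.finite_toSet _) fun r hr => ?_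
    have hr0 : r ≠ 0 := (Finset.mem_filter.mp hr).2
    exact FinitePlace.hasFiniteMulSupport hr0
  set S : Finset (FinitePlace L) := hTfin.toFinset with hS
  have hSa : (Function.mulSupport fun v : FinitePlace L => v a) ⊆ ↑S := by
    intro v hv; rw [hS, Set.Finite.coe_toFinset]; exact Or.inl hv
  have hSr : ∀ r ∈ Q.roots, (Function.support fun v : FinitePlace L => Real.log (max 1 (v r))) ⊆ ↑S := by
    intro r hr v hv
    rw [Function.mem_support] at hv
    have hvr : v r ≠ 1 := by intro h1; rw [h1, max_self, Real.log_one] at hv; exact hv rfl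
    have hr0 : r ≠ 0 := by intro h0; rw [h0, map_zero, max_eq_left zero_le_one, Real.log_one] at hv; exact hv rfl
    rw [hS, Set.Finite.coe_toFinset, hT]
    refine Or.inr (Set.mem_biUnion (x := r) ?_ hvr)
    exact Finset.mem_filter.mpr ⟨Multiset.mem_toFinset.mpr hr, hr0⟩
  -- the height of each root as finite sums
  have hheight : ∀ r ∈ Q.roots, logHeight₁ r =
      (∑ w : InfinitePlace L, (w.mult : ℝ) * Real.log (max 1 (w r))) + ∑ v ∈ S, Real.log (max 1 (v r)) := by
    intro r hr
    rw [NumberField.logHeight₁_eq]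
    congr 1
    · refine Finset.sum_congr rfl fun w _ => ?_
      rw [Real.posLog_eq_log_max_one (apply_nonneg _ _)]
    · rw [← finsum_eq_sum_of_support_subset _ (hSr r hr)]
      refine finsum_congr fun v => ?_
      rw [Real.posLog_eq_log_max_one (apply_nonneg _ _)]
  have hsum1 : (Q.roots.map fun r => logHeight₁ r).sum =
      (Q.roots.map fun r => (∑ w : InfinitePlace L, (w.mult : ℝ) * Real.log (max 1 (w r))) +
        ∑ v ∈ S, Real.log (max 1 (v r))).sum :=
    congrArg Multiset.sum (Multiset.map_congr rfl hheight)
  rw [hsum1, Multiset.sum_map_add, Multiset.sum_map_sum, Multiset.sum_map_sum]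
  -- archimedean part
  have harch : ∀ w : InfinitePlace L, (Q.roots.map fun r => (w.mult : ℝ) * Real.log (max 1 (w r))).sum =
      (w.mult : ℝ) * (Real.log (P.map (Int.castRingHom ℂ)).mahlerMeasure - Real.log |(P.leadingCoeff : ℝ)|) := by
    intro w
    rw [Multiset.sum_map_mul_left, sum_roots_log_infinitePlace w hd hsplit]
  -- finite part
  have hfinite : ∀ v ∈ S, (Q.roots.map fun r => Real.log (max 1 (v r))).sum = -Real.log (v a) := by
    intro v _
    exact sum_roots_log_finitePlace v hP hsplit
  rw [Finset.sum_congr rfl fun w _ => harch w, Finset.sum_congr rfl hfinite, ← Finset.sum_mul,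
    Finset.sum_neg_distrib]
  -- product formula for `a`
  have hpf := NumberField.prod_abs_eq_one ha0
  rw [finprod_eq_prod_of_mulSupport_subset _ hSa] at hpf
  have hwa : ∀ w : InfinitePlace L, w a = |(P.leadingCoeff : ℝ)| := fun w => infinitePlace_intCast w _
  have habs : 0 < |(P.leadingCoeff : ℝ)| := abs_pos.mpr (by exact_mod_cast hlead0)
  have hprod1 : ∏ w : InfinitePlace L, w a ^ w.mult = |(P.leadingCoeff : ℝ)| ^ Module.finrank ℚ L := by
    rw [Finset.prod_congr rfl fun w _ => by rw [hwa w], Finset.prod_pow_eq_pow_sum, InfinitePlace.sum_mult_eq]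
  rw [hprod1] at hpf
  have hva : ∀ v ∈ S, 0 < v a := fun v _ => (FinitePlace.pos_iff).mpr ha0
  have hlogpf := congrArg Real.log hpf
  rw [Real.log_mul (pow_pos habs _).ne' (Finset.prod_pos hva).ne', Real.log_one, Real.log_pow,
    Real.log_prod (fun v hv => (hva v hv).ne')] at hlogpf
  have hmult : (∑ w : InfinitePlace L, (w.mult : ℝ)) = Module.finrank ℚ L := by
    rw [← InfinitePlace.sum_mult_eq (K := L)]; push_cast; rfl
  rw [hmult]
  linarith

/-- In a normal number field containing the roots of an irreducible `P ∈ ℤ[X]`, **all the roots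
of `P` have the same height** (they are Galois conjugate). [folklore] -/
theorem logHeight₁_root_eq_of_normal [Normal ℚ L] (hP : Irreducible P) (hd : 0 < P.natDegree)
    {x y : L} (hx : aeval x P = 0) (hy : aeval y P = 0) : logHeight₁ x = logHeight₁ y := by
  have hP0 : P ≠ 0 := by rintro rfl; simp at hd
  have hprim : P.IsPrimitive := hP.isPrimitive (by omega)
  set p : ℚ[X] := P.map (Int.castRingHom ℚ) with hp
  have hpirr : Irreducible p := (hprim.irreducible_iff_irreducible_map_fraction_map (K := ℚ)).mp hP
  have hp0 : p ≠ 0 := hpirr.ne_zero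
  have haeval : ∀ z : L, aeval z p = aeval z P := fun z => by
    rw [hp]
    exact aeval_map_algebraMap ℚ z P
  have hmin : ∀ z : L, aeval z P = 0 → minpoly ℚ z = p * C (p.leadingCoeff)⁻¹ := by
    intro z hz
    symm
    refine minpoly.eq_of_irreducible_of_monic (irreducible_mul_leadingCoeff_inv.mpr hpirr) ?_
      (monic_mul_leadingCoeff_inv hp0)
    rw [map_mul, haeval, hz, zero_mul]
  have hyalg : IsAlgebraic ℚ y := ⟨p, hp0, by rw [haeval, hy]⟩
  have hev : aeval x (minpoly ℚ y) = 0 := by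
    rw [hmin y hy, map_mul, haeval, hx, zero_mul]
  obtain ⟨σ, hσ⟩ := minpoly.exists_algEquiv_of_root hyalg hev
  rw [← hσ]
  exact (NumberField.logHeight₁_map_ringHom_self (σ : L ≃ₐ[ℚ] L).toAlgHom.toRingHom x).symm

/-- `d · h_L(α) = [L:ℚ] · log M(P)` for a root `α` of the irreducible `P ∈ ℤ[X]` of degree `d`
in a normal number field `L` where `P` splits. [folklore] -/
theorem natDegree_mul_logHeight₁_eq [Normal ℚ L] (hP : Irreducible P) (hd : 0 < P.natDegree)
    (hsplit : (P.map (Int.castRingHom L)).roots.card = P.natDegree) {x : L} (hx : aeval x P = 0) :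
    (P.natDegree : ℝ) * logHeight₁ x =
      Module.finrank ℚ L * Real.log (P.map (Int.castRingHom ℂ)).mahlerMeasure := by
  have hprim : P.IsPrimitive := hP.isPrimitive (by omega)
  rw [← sum_roots_logHeight₁ hprim hd hsplit]
  have hall : ∀ r ∈ (P.map (Int.castRingHom L)).roots, logHeight₁ r = logHeight₁ x := by
    intro r hr
    have hr' : aeval r P = 0 := by
      have h := (mem_roots'.mp hr).2
      rw [IsRoot, eval_map] at h
      exact h
    exact logHeight₁_root_eq_of_normal hP hd hr' hx
  rw [Multiset.map_congr rfl hall, Multiset.map_const', Multiset.sum_replicate, hsplit, nsmul_eq_mul]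

end main

/-! ### The normalised height of a complex algebraic number -/

/-- **`h(α) = (1/d) log M(P)`**: the absolute logarithmic Weil height of a complex root `α` of an
irreducible `P ∈ ℤ[X]` of degree `d ≥ 1`, computed in any number field `F ⊂ ℂ` containing `α`
(the tree's `weilHeight₁ F`), is the logarithm of the Mahler measure of `P` divided by `d`.
[cite: RoyWaldschmidt1997ENS, §3, p. 763] -/
theorem weilHeight₁_root_eq (P : ℤ[X]) (hP : Irreducible P) (hd : 0 < P.natDegree) {α : ℂ}
    (hα : aeval α P = 0) (F : IntermediateField ℚ ℂ) [FiniteDimensional ℚ F] (hαF : α ∈ F) :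
    weilHeight₁ F (fun _ : Unit => α) =
      Real.log (P.map (Int.castRingHom ℂ)).mahlerMeasure / P.natDegree := by
  classical
  have hP0 : P ≠ 0 := by rintro rfl; simp at hd
  have hprim : P.IsPrimitive := hP.isPrimitive (by omega)
  set p : ℚ[X] := P.map (Int.castRingHom ℚ) with hp
  have hpirr : Irreducible p := (hprim.irreducible_iff_irreducible_map_fraction_map (K := ℚ)).mp hP
  have hp0 : p ≠ 0 := hpirr.ne_zero
  have hpC : p.map (algebraMap ℚ ℂ) = P.map (Int.castRingHom ℂ) := by
    rw [hp, Polynomial.map_map]; congr 1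
  have hsplitsC : (p.map (algebraMap ℚ ℂ)).Splits := IsAlgClosed.splits _
  -- the splitting field `L ⊂ ℂ`
  set L : IntermediateField ℚ ℂ := IntermediateField.adjoin ℚ (p.rootSet ℂ) with hL
  haveI hsf : p.IsSplittingField ℚ L := IntermediateField.adjoin_rootSet_isSplittingField hsplitsC
  haveI : Normal ℚ L := Normal.of_isSplittingField p
  haveI : FiniteDimensional ℚ L := by
    refine IntermediateField.finiteDimensional_adjoin fun x hx => ?_
    exact (isAlgebraic_of_mem_rootSet hx).isIntegral
  haveI : NumberField L := numberField_of_intermediateField L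
  have hαroot : α ∈ p.rootSet ℂ := by
    rw [mem_rootSet]
    refine ⟨hp0, ?_⟩
    rw [hp]
    exact (aeval_map_algebraMap ℚ α P).trans hα
  have hαL : α ∈ L := IntermediateField.subset_adjoin ℚ _ hαroot
  -- `P` splits in `L`
  have hsplitL : (P.map (Int.castRingHom L)).roots.card = P.natDegree := by
    have h1 : (p.map (algebraMap ℚ L)).Splits := hsf.splits
    have h2 : p.map (algebraMap ℚ L) = P.map (Int.castRingHom L) := by
      rw [hp, Polynomial.map_map]; congr 1
    rw [h2, splits_iff_card_roots] at h1
    rw [h1, natDegree_map_eq_of_injective (Int.castRingHom L).injective_int]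
  -- the root in `L`
  set xL : L := ⟨α, hαL⟩ with hxL
  have hxLroot : aeval xL P = 0 := by
    have h : algebraMap L ℂ (aeval xL P) = aeval α P := by
      rw [← aeval_algebraMap_apply]; rfl
    rw [hα] at h
    exact (map_eq_zero_iff _ (algebraMap L ℂ).injective).mp h
  have hmain := natDegree_mul_logHeight₁_eq hP hd hsplitL hxLroot
  -- `ℚ(α)` inside `F` and inside `L`
  set F₀ : IntermediateField ℚ ℂ := IntermediateField.adjoin ℚ {α} with hF₀
  have hαint : IsIntegral ℚ α := (isAlgebraic_of_mem_rootSet hαroot).isIntegral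
  haveI : FiniteDimensional ℚ F₀ := IntermediateField.adjoin.finiteDimensional hαint
  haveI : NumberField F₀ := numberField_of_intermediateField F₀
  haveI : NumberField F := numberField_of_intermediateField F
  have hF₀F : F₀ ≤ F := IntermediateField.adjoin_le_iff.mpr (Set.singleton_subset_iff.mpr hαF)
  have hF₀L : F₀ ≤ L := IntermediateField.adjoin_le_iff.mpr (Set.singleton_subset_iff.mpr hαL)
  have hαF₀ : α ∈ F₀ := IntermediateField.mem_adjoin_simple_self ℚ α
  set x₀ : F₀ := ⟨α, hαF₀⟩ with hx₀
  have h1 := NumberField.logHeight₁_map_ringHom (IntermediateField.inclusion hF₀F).toRingHom x₀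
  have h2 := NumberField.logHeight₁_map_ringHom (IntermediateField.inclusion hF₀L).toRingHom x₀
  have e1 : (IntermediateField.inclusion hF₀F).toRingHom x₀ = (⟨α, hαF⟩ : F) := rfl
  have e2 : (IntermediateField.inclusion hF₀L).toRingHom x₀ = xL := rfl
  rw [e1] at h1
  rw [e2] at h2
  rw [weilHeight₁_single_eq F hαF]
  have hF0 : (0 : ℝ) < Module.finrank ℚ F₀ := by exact_mod_cast Module.finrank_pos
  have hF : (0 : ℝ) < Module.finrank ℚ F := by exact_mod_cast Module.finrank_pos
  have hLp : (0 : ℝ) < Module.finrank ℚ L := by exact_mod_cast Module.finrank_pos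
  have hdp : (0 : ℝ) < P.natDegree := by exact_mod_cast hd
  rw [div_eq_div_iff hF.ne' hdp.ne']
  -- from `h1`, `h2`, `hmain` by cancelling the positive degrees
  have key : (Module.finrank ℚ F₀ : ℝ) * (logHeight₁ (⟨α, hαF⟩ : F) * P.natDegree) =
      (Module.finrank ℚ F₀ : ℝ) * (Real.log (P.map (Int.castRingHom ℂ)).mahlerMeasure * Module.finrank ℚ F) := by
    have e3 : (Module.finrank ℚ F₀ : ℝ) * (logHeight₁ (⟨α, hαF⟩ : F) * P.natDegree) =
        (Module.finrank ℚ F : ℝ) * (P.natDegree * logHeight₁ x₀) := by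
      calc _ = ((Module.finrank ℚ F₀ : ℝ) * logHeight₁ (⟨α, hαF⟩ : F)) * P.natDegree := by ring
        _ = ((Module.finrank ℚ F : ℝ) * logHeight₁ x₀) * P.natDegree := by rw [h1]
        _ = _ := by ring
    have e4 : (Module.finrank ℚ F₀ : ℝ) * ((P.natDegree : ℝ) * logHeight₁ xL) =
        (Module.finrank ℚ L : ℝ) * (P.natDegree * logHeight₁ x₀) := by
      calc _ = ((Module.finrank ℚ F₀ : ℝ) * logHeight₁ xL) * P.natDegree := by ring
        _ = ((Module.finrank ℚ L : ℝ) * logHeight₁ x₀) * P.natDegree := by rw [h2]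
        _ = _ := by ring
    rw [hmain] at e4
    -- eliminate `logHeight₁ x₀`
    have e5 : (P.natDegree : ℝ) * logHeight₁ x₀ =
        (Module.finrank ℚ F₀ : ℝ) * Real.log (P.map (Int.castRingHom ℂ)).mahlerMeasure := by
      have := e4
      field_simp at this
      nlinarith [this, hLp]
    rw [e3, e5]; ring
  have := mul_left_cancel₀ hF0.ne' key
  linarith

/-- `h(α) ≤ (1/d) log M(P)` (the inequality actually used). [cite: RoyWaldschmidt1997ENS, §3, p. 763] -/
theorem weilHeight₁_root_le (P : ℤ[X]) (hP : Irreducible P) (hd : 0 < P.natDegree) {α : ℂ}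
    (hα : aeval α P = 0) (F : IntermediateField ℚ ℂ) [FiniteDimensional ℚ F] (hαF : α ∈ F) :
    weilHeight₁ F (fun _ : Unit => α) ≤
      Real.log (P.map (Int.castRingHom ℂ)).mahlerMeasure / P.natDegree :=
  (weilHeight₁_root_eq P hP hd hα F hαF).le

end MahlerWeil

end RoyWaldschmidt1997

end Literature.NumberTheory.Transcendental
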